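import Literature.NumberTheory.GaloisCohomology.CorrectionAtPArithmetic
import Literature.NumberTheory.GaloisCohomology.KummerClassLocalPower
import Literature.NumberTheory.GaloisCohomology.PoitouTatePrimaryReduction
import Literature.NumberTheory.GaloisCohomology.LocalInvariantMapLevelChange
import HarnessLib

/-!
# Tate's correction at `p` from an auxiliary character (Cassels–Fröhlich VII §11, "pre-reduction")

Let `K` be a totally complex number field, `p` a prime, `y ∈ H²(Γ_K, μ_{p^{m+1}})` a class whose
local invariants vanish off the finite set `S`.  Suppose an AUXILIARY CHARACTER is supplied
(hypothesis `CharSupply`, spelled out inline — the export asked of the tree's mod-`q` cyclotomic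
character file): a cyclic `ψ : Γ_K ↠ ℤ/p^e`, `e ≥ m+1`, cutting out a finite abelian `L ⊆ K̄`,
together with a finite set `Q` of places (those above an auxiliary prime `q`) such that
(c1) `Q` avoids `S` and the places above `p`; (c2) `ψ` kills the inertia groups `I_{K_v}` for
`v ∉ Q`; (c4) at every `v ∣ p` the value `ψ(Frob_v)` satisfies `gcd(ψ(Frob_v), p^e) ∣ p^{e-m-1}`
(Tate's "the Frobenius at `v` has large order in `Gal(L/K)`").

**Theorem** (`correction_of_characterSupply`).  Then `y` can be corrected: with `y_e` the image of
`y` in `H²(μ_{p^e})` there are `a ∈ Kˣ` and the cyclic class `γ = κ_{p^e}(a) ∪ ψ` such that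
`y' := y_e − γ` VANISHES AT EVERY PLACE ABOVE `p`, has local invariants supported in a finite
`S' ⊇ S`, and `∑_{v ∈ T} inv_v(loc_v y') = p^{e-m-1} · ∑_{v ∈ T} inv_v(loc_v y)` for every finite
`T ⊇ S'` — exactly the hypothesis `hpre` of the tree's assembly
`poitouTate_sum_localTatePairing_eq_zero_of_isTotallyComplex_of_correction` (`PoitouTateTotallyComplex.lean`).

Construction (Tate VII §11): at `v ∣ p`, `ψ` is unramified (c1, c2), `inv_v(κ(x) ∪ ψ) = f_v·ord_v(x)`
with `f_v = ψ(Frob_v)` (`localInvariantMap_localization_cupProduct_δ₀`); the target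
`inv_v(loc y_e) = p^{e-m-1}·inv_v(loc y)` is a multiple `k_v f_v` by (c4)
(`ZMod.exists_natCast_mul_eq_of_gcd_dvd`); choose `a` with `ord_v(a) = k_v` at `v ∣ p` and
`a ≡ 1 (mod 𝔭_w)` for `w ∈ Q` (`exists_ord_eq_and_valuation_sub_one_lt`); then `γ` matches `y_e`
above `p`, vanishes above `q` (`a` is a `p^e`-th power there, Hensel;
`localization_cupProduct_δ₀_eq_zero_of_valuation_sub_one_lt`) — in particular wherever `ψ`
ramifies — so `∑_v inv_v(γ) = 0` by the cyclic reciprocity law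
(`sum_localInvariantMap_localization_cupProduct_δ₀_eq_zero_of_isTotallyComplex`).
Theorems only; no named fact (D-0026).

## References

* J. Tate, *Global class field theory*, Ch. VII of Cassels–Fröhlich (1967), §11. [CasselsFrohlichANT1967]
* J.-P. Serre, *Corps locaux* (1979), XIV §1. [SerreLocalFields1979]
-/

noncomputable section

open CategoryTheory Function Field NumberField IsDedekindDomain
open scoped NumberField

namespace Literature.NumberTheory.GaloisCohomology

open _root_.ContinuousCohomology
open Literature.NumberTheory.GaloisRepresentations
open Literature.NumberTheory.GaloisRepresentations.DiscreteGaloisModule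
open Literature.NumberTheory.GaloisRepresentations.LocalWeilDatum
open Literature.AnabelianGeometry.AbsoluteAnabelian
open Literature.AnabelianGeometry.AbsoluteAnabelian.Prop121vii

variable (K : Type) [Field K] [NumberField K] (p : ℕ) [hp : Fact p.Prime]

omit [NumberField K] in
/-- The level-raising map `r ↦ r · p^(e-m-1) : ℤ/p^(m+1) → ℤ/p^e` (read on representatives) is
additive over finite sums. [folklore] -/
private theorem sum_val_mul_pow_cast {ι : Type*} {m e : ℕ} (hme : m + 1 ≤ e) (T : Finset ι)
    (r : ι → ZMod (p ^ (m + 1))) :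
    ∑ i ∈ T, (((r i).val * p ^ (e - m - 1) : ℕ) : ZMod (p ^ e)) =
      (((∑ i ∈ T, r i).val * p ^ (e - m - 1) : ℕ) : ZMod (p ^ e)) := by
  classical
  have hpe : p ^ (m + 1) * p ^ (e - m - 1) = p ^ e := by rw [← pow_add]; congr 1; omega
  -- the map is additive
  have hadd : ∀ a b : ZMod (p ^ (m + 1)), (((a + b).val * p ^ (e - m - 1) : ℕ) : ZMod (p ^ e)) =
      ((a.val * p ^ (e - m - 1) : ℕ) : ZMod (p ^ e)) + ((b.val * p ^ (e - m - 1) : ℕ) : ZMod (p ^ e)) := by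
    intro a b
    rw [← Nat.cast_add, ← add_mul, ZMod.val_add]
    have hdiv := Nat.mod_add_div (a.val + b.val) (p ^ (m + 1))
    conv_rhs => rw [← hdiv]
    rw [add_mul, Nat.cast_add, mul_assoc, mul_comm (_ / _), ← mul_assoc, hpe, Nat.cast_mul (p ^ e),
      ZMod.natCast_self, zero_mul, add_zero]
  let φ : ZMod (p ^ (m + 1)) →+ ZMod (p ^ e) :=
    { toFun := fun a => ((a.val * p ^ (e - m - 1) : ℕ) : ZMod (p ^ e))
      map_zero' := by rw [ZMod.val_zero, zero_mul, Nat.cast_zero]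
      map_add' := hadd }
  exact (map_sum φ r T).symm

/-- **Tate's correction at `p` from a supplied auxiliary character** (Cassels–Fröhlich VII §11; see
the module docstring): the conclusion is the hypothesis `hpre` of
`poitouTate_sum_localTatePairing_eq_zero_of_isTotallyComplex_of_correction`, token for token.
[cite: CasselsFrohlichANT1967, Ch. VII §11] -/
theorem correction_of_characterSupply [IsTotallyComplex K] (m : ℕ)
    (hsup : ∀ S : Finset (HeightOneSpectrum (𝓞 K)), ∃ e : ℕ, m + 1 ≤ e ∧
      ∃ (ψ : CyclicCharacter (absoluteGaloisGroup K) (p ^ e)) (L : IntermediateField K (AlgebraicClosure K))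
        (_ : FiniteDimensional K L) (_ : IsAbelianGalois K L) (Q : Finset (HeightOneSpectrum (𝓞 K))),
        ψ.ker = galFixing K L ∧ (∀ w ∈ Q, w ∉ S ∧ (p : 𝓞 K) ∉ w.asIdeal) ∧
        (∀ v : HeightOneSpectrum (𝓞 K), v ∉ Q → ∀ σ ∈ absInertia (v.adicCompletion K),
          ψ (absGaloisRestrict K (v.adicCompletion K) σ) = 0) ∧
        (∀ v : HeightOneSpectrum (𝓞 K), (p : 𝓞 K) ∈ v.asIdeal →
          ∀ φ : absoluteGaloisGroup (v.adicCompletion K), IsFrobPow φ 1 →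
            Nat.gcd (ψ (absGaloisRestrict K (v.adicCompletion K) φ)).val (p ^ e) ∣ p ^ (e - m - 1)))
    (y : galoisCohomology (mu K (p ^ (m + 1))) 2) (S : Finset (HeightOneSpectrum (𝓞 K)))
    (hS : ∀ v ∉ S, localInvariantMap K (p ^ (m + 1)) v
      (galoisCohomology.localization (mu K (p ^ (m + 1))) (Sum.inr v) 2 y) = 0) :
    ∃ e : ℕ, m + 1 ≤ e ∧ ∃ (y' : galoisCohomology (mu K (p ^ e)) 2) (S' : Finset (HeightOneSpectrum (𝓞 K))),
      S ⊆ S' ∧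
      (∀ v : HeightOneSpectrum (𝓞 K), (p : 𝓞 K) ∈ v.asIdeal →
        galoisCohomology.localization (mu K (p ^ e)) (Sum.inr v) 2 y' = 0) ∧
      (∀ v ∉ S', localInvariantMap K (p ^ e) v
        (galoisCohomology.localization (mu K (p ^ e)) (Sum.inr v) 2 y') = 0) ∧
      (∀ T : Finset (HeightOneSpectrum (𝓞 K)), S' ⊆ T →
        ∑ v ∈ T, localInvariantMap K (p ^ e) v (galoisCohomology.localization (mu K (p ^ e)) (Sum.inr v) 2 y') =
          (((∑ v ∈ T, localInvariantMap K (p ^ (m + 1)) v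
            (galoisCohomology.localization (mu K (p ^ (m + 1))) (Sum.inr v) 2 y)).val * p ^ (e - m - 1) : ℕ) :
            ZMod (p ^ e))) := by
  classical
  have hpp : p.Prime := hp.out
  haveI : CompactSpace (absoluteGaloisGroup K) := absoluteGaloisGroup_compactSpace K
  obtain ⟨e, hme, ψ, L, hLfin, hLab, Q, hker, hQ, hunr, hfrob⟩ := hsup S
  haveI := hLfin
  haveI := hLab
  haveI : NumberField L := NumberField.of_module_finite K L
  have hdvd : p ^ (m + 1) ∣ p ^ e := pow_dvd_pow p hme
  have hpe : p ^ (m + 1) * p ^ (e - m - 1) = p ^ e := by rw [← pow_add]; congr 1; omega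
  have hediv : p ^ e / p ^ (m + 1) = p ^ (e - m - 1) := by
    rw [Nat.pow_div hme hpp.pos]; congr 1
  have hn1 : 1 < p ^ e := Nat.one_lt_pow (by omega) hpp.one_lt
  set ye : galoisCohomology (mu K (p ^ e)) 2 := cohomologyMap (muInclHom K hdvd) 2 y with hye
  -- notation: invariants and localisations at level `p^e`
  let loc := fun (v : HeightOneSpectrum (𝓞 K)) (z : galoisCohomology (mu K (p ^ e)) 2) =>
    galoisCohomology.localization (mu K (p ^ e)) (Sum.inr v) 2 z
  let inv := fun (v : HeightOneSpectrum (𝓞 K)) (z : galoisCohomology (mu K (p ^ e)) 2) =>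
    localInvariantMap K (p ^ e) v (loc v z)
  let r := fun (v : HeightOneSpectrum (𝓞 K)) =>
    localInvariantMap K (p ^ (m + 1)) v (galoisCohomology.localization (mu K (p ^ (m + 1))) (Sum.inr v) 2 y)
  have hinv_ye : ∀ v, inv v ye = (((r v).val * p ^ (e - m - 1) : ℕ) : ZMod (p ^ e)) := fun v => by
    have h := localInvariantMap_localization_cohomologyMap_muInclHom (K := K) hdvd v y
    rw [hediv] at h
    exact h
  -- the places above `p`
  have hp0 : ((p : 𝓞 K) : K) ≠ 0 := by exact_mod_cast hpp.ne_zero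
  set P : Finset (HeightOneSpectrum (𝓞 K)) :=
    (finite_setOf_valued_ne_one (Units.mk0 ((p : 𝓞 K) : K) hp0)).toFinset with hPdef
  have hPmem : ∀ v : HeightOneSpectrum (𝓞 K), v ∈ P ↔ (p : 𝓞 K) ∈ v.asIdeal := by
    intro v
    rw [hPdef, Set.Finite.mem_toFinset, Set.mem_setOf_eq, Units.val_mk0, valued_algebraMap_adicCompletion,
      ← HeightOneSpectrum.valuation_lt_one_iff_mem (K := K), lt_iff_le_and_ne]
    exact ⟨fun h => ⟨HeightOneSpectrum.valuation_le_one v _, h⟩, fun h => h.2⟩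
  have hPQ : Disjoint P Q := by
    rw [Finset.disjoint_left]
    intro v hvP hvQ
    exact (hQ v hvQ).2 ((hPmem v).mp hvP)
  -- the unramified evaluation at every `v ∉ Q`
  have hloc : ∀ v : HeightOneSpectrum (𝓞 K), v ∉ Q → ∃ f : ℕ,
      (∀ (x : K) (hx : x ≠ 0), inv v (((mu K (p ^ e)).tateDualPairing (p ^ e)).cupProduct
          ((isSES_kummer K (p ^ e) (NeZero.pos _)).δ₀ (baseUnitsInvariant K x hx))
          (oneCocycleClass _ (scalarCocycle ψ))) =
        (f : ZMod (p ^ e)) * (ord (v.adicCompletion K) (algebraMap K (v.adicCompletion K) x) : ZMod (p ^ e))) ∧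
      ∀ φ : absoluteGaloisGroup (v.adicCompletion K), IsFrobPow φ 1 →
        ψ (absGaloisRestrict K (v.adicCompletion K) φ) = (f : ZMod (p ^ e)) := by
    intro v hvQ
    haveI : CharZero (v.adicCompletion K) := charZero_adicCompletion v
    obtain ⟨ψE, hIE, hFE, -, -⟩ := exists_normalizedCharacter (v.adicCompletion K) (p ^ e) hn1
    obtain ⟨f, hψf, hf⟩ := exists_apply_absGaloisRestrict_eq_mul (v.adicCompletion K) ψ (hunr v hvQ) ψE hIE hFE
    exact ⟨f, fun x hx => localInvariantMap_localization_cupProduct_δ₀ v ψ ψE hIE hFE hψf x hx, hf⟩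
  choose! f hf hfφ using hloc
  -- the multipliers `k_v` at the places above `p`
  have hk : ∀ v : HeightOneSpectrum (𝓞 K), v ∈ P → ∃ k : ℕ, (k : ZMod (p ^ e)) * (f v : ZMod (p ^ e)) = inv v ye := by
    intro v hv
    have hvp : (p : 𝓞 K) ∈ v.asIdeal := (hPmem v).mp hv
    have hvQ : v ∉ Q := fun h => (hQ v h).2 hvp
    obtain ⟨φ, hφ⟩ := exists_isAbsArithFrob_holds (v.adicCompletion K)
    have hφ1 : IsFrobPow φ 1 := IsAbsArithFrob.isFrobPow_holds hφ
    have hg := hfrob v hvp φ hφ1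
    rw [hfφ v hvQ φ hφ1] at hg
    refine ZMod.exists_natCast_mul_eq_of_gcd_dvd _ _ (hg.trans ?_)
    rw [hinv_ye v, ZMod.val_natCast, Nat.mod_eq_of_lt]
    · exact Dvd.intro_left _ rfl
    · calc (r v).val * p ^ (e - m - 1) < p ^ (m + 1) * p ^ (e - m - 1) :=
          Nat.mul_lt_mul_of_lt_of_le (ZMod.val_lt _) le_rfl (pow_pos hpp.pos _)
        _ = p ^ e := hpe
  choose! k hk using hk
  -- the auxiliary element `a`
  obtain ⟨a, ha0, haP, haQ⟩ := exists_ord_eq_and_valuation_sub_one_lt P Q hPQ k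
  set γ : galoisCohomology (mu K (p ^ e)) 2 := ((mu K (p ^ e)).tateDualPairing (p ^ e)).cupProduct
      ((isSES_kummer K (p ^ e) (NeZero.pos _)).δ₀ (baseUnitsInvariant K a ha0))
      (oneCocycleClass _ (scalarCocycle ψ)) with hγ
  -- (γ1) `γ` matches `y_e` above `p`
  have hγP : ∀ v ∈ P, loc v ye = loc v γ := by
    intro v hv
    have hvQ : v ∉ Q := fun h => (hQ v h).2 ((hPmem v).mp hv)
    apply (localInvariantMap_bijective (K := K) (n := p ^ e) v).1
    change inv v ye = inv v γ
    rw [hγ, hf v hvQ a ha0, haP v hv, ← hk v hv, Int.cast_natCast, mul_comm]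
  -- (γ2) `γ` vanishes above `q`
  have hγQ : ∀ w ∈ Q, loc w γ = 0 := by
    intro w hw
    have hpw : ((p ^ e : ℕ) : 𝓞 K) ∉ w.asIdeal := by
      rw [Nat.cast_pow]
      exact fun h => (hQ w hw).2 (w.isPrime.mem_of_pow_mem _ h)
    exact localization_cupProduct_δ₀_eq_zero_of_valuation_sub_one_lt w hpw a ha0 (haQ w hw) _
  -- (γ3) the support of `γ`
  set Sa : Finset (HeightOneSpectrum (𝓞 K)) := (finite_setOf_valued_ne_one (Units.mk0 a ha0)).toFinset with hSa
  have hγ0 : ∀ v ∉ Q ∪ Sa, inv v γ = 0 := by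
    intro v hv
    rw [Finset.notMem_union] at hv
    have hval : Valued.v (algebraMap K (v.adicCompletion K) a) = 1 := by
      by_contra h
      exact hv.2 ((finite_setOf_valued_ne_one (Units.mk0 a ha0)).mem_toFinset.mpr h)
    have hord : ord (v.adicCompletion K) (algebraMap K (v.adicCompletion K) a) = 0 :=
      ord_adicCompletion_eq_of_valued_eq v ((map_ne_zero_iff _ (algebraMap K _).injective).2 ha0)
        (e := 0) (by rw [hval, neg_zero, WithZero.exp_zero])
    change inv v γ = 0
    rw [hγ, hf v hv.1 a ha0, hord, Int.cast_zero, mul_zero]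
  -- (γ4) the cyclic reciprocity law for `γ`
  have hram : ∀ v : HeightOneSpectrum (𝓞 K),
      (∃ σ ∈ absInertia (v.adicCompletion K), ψ (absGaloisRestrict K (v.adicCompletion K) σ) ≠ 0) → loc v γ = 0 := by
    rintro v ⟨σ, hσ, hne⟩
    have hvQ : v ∈ Q := by
      by_contra h
      exact hne (hunr v h σ hσ)
    exact hγQ v hvQ
  have hγsum : ∀ T : Finset (HeightOneSpectrum (𝓞 K)), Q ∪ Sa ⊆ T → ∑ v ∈ T, inv v γ = 0 := by
    intro T hT
    have h0 := sum_localInvariantMap_localization_cupProduct_δ₀_eq_zero_of_isTotallyComplex L ψ hker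
      (Units.mk0 a ha0) hram (Q ∪ Sa) hγ0
    rw [← Finset.sum_subset hT (fun v _ hv => hγ0 v hv)]
    exact h0
  -- outputs
  refine ⟨e, hme, ye - γ, S ∪ P ∪ (Q ∪ Sa), Finset.subset_union_left.trans Finset.subset_union_left,
    fun v hv => ?_, fun v hv => ?_, fun T hT => ?_⟩
  · -- vanishing above `p`
    rw [map_sub]
    change loc v ye - loc v γ = 0
    rw [hγP v ((hPmem v).mpr hv), sub_self]
  · -- support
    rw [Finset.notMem_union, Finset.notMem_union] at hv
    change inv v (ye - γ) = 0
    have h1 : inv v ye = 0 := by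
      rw [hinv_ye v, show r v = 0 from hS v hv.1.1, ZMod.val_zero, zero_mul, Nat.cast_zero]
    change localInvariantMap K (p ^ e) v (galoisCohomology.localization (mu K (p ^ e)) (Sum.inr v) 2 (ye - γ)) = 0
    rw [map_sub, map_sub]
    change inv v ye - inv v γ = 0
    rw [h1, hγ0 v hv.2, sub_zero]
  · -- the sum identity
    have hT' : Q ∪ Sa ⊆ T := Finset.subset_union_right.trans hT
    calc ∑ v ∈ T, localInvariantMap K (p ^ e) v (loc v (ye - γ))
        = ∑ v ∈ T, (inv v ye - inv v γ) := Finset.sum_congr rfl fun v _ => by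
          change localInvariantMap K (p ^ e) v
            (galoisCohomology.localization (mu K (p ^ e)) (Sum.inr v) 2 (ye - γ)) = _
          rw [map_sub, map_sub]
      _ = ∑ v ∈ T, inv v ye - ∑ v ∈ T, inv v γ := Finset.sum_sub_distrib _ _
      _ = ∑ v ∈ T, inv v ye := by rw [hγsum T hT', sub_zero]
      _ = ∑ v ∈ T, (((r v).val * p ^ (e - m - 1) : ℕ) : ZMod (p ^ e)) := Finset.sum_congr rfl fun v _ => hinv_ye v
      _ = _ := sum_val_mul_pow_cast p hme T r

end Literature.NumberTheory.GaloisCohomology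

end
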